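import Mathlib
import Literature.MathematicalPhysics.StatisticalMechanics.LocalMatchingCompactness

/-!
# Crux `GappedShellCensus.FiveFoldRationingR` (stmt-AtomisticToContinuum-18071), line `Sketch` —
# stub `stub_ffrCounting` (the counting glue "CensusClosesCrux")

Setting: `Y ⊆ ℝ³` all-gapped-twelve at scale `a > 0` (hard core `0.98 a`), non-empty, `3a`-relatively
dense, with a LINEAR CENSUS of five-sites: the set `F` of sites carrying a bond with `≥ 5` common
partners satisfies `ncard (F ∩ B̄(p, r)) ≤ C · r / a` for all `p` and all `r ≥ a`.  Conclusion: for
every `R` some site `c` has no five-site bond starting within `R` of it.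

Proof (by contradiction).  If every site had a five-site within `R`, then `R ≥ 0` and, by relative
denseness, every POINT of space has a five-site within `ρ := R + 3a`.  Take the planar grid
`(3ρ i) e₀ + (3ρ j) e₁`, `i, j < n`, for an orthonormal pair `e₀, e₁`: distinct grid points are `≥ 3ρ`
apart, so the five-sites chosen within `ρ` of them are pairwise distinct, and they all lie in
`B̄(0, 7ρn)`.  The hard core makes `F ∩ B̄(0, 7ρn)` finite, so the census gives `n² ≤ C · 7ρn / a` for
every `n ≥ 1`, which fails for `n > max 1 (7Cρ/a)`.
-/

noncomputable section

namespace Summit.AtomisticToContinuum.Crystallization.Theorems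

open Literature.MathematicalPhysics.StatisticalMechanics

/-- An orthonormal pair of vectors in `ℝ³` (two members of the standard basis). -/
theorem ffrCount_exists_orthoPair :
    ∃ e₀ e₁ : EuclideanSpace ℝ (Fin 3), ‖e₀‖ = 1 ∧ ‖e₁‖ = 1 ∧ inner ℝ e₀ e₁ = 0 :=
  let b := EuclideanSpace.basisFun (Fin 3) ℝ
  ⟨b 0, b 1, b.orthonormal.1 0, b.orthonormal.1 1, b.orthonormal.2 (show (0 : Fin 3) ≠ 1 by decide)⟩

/-- Pythagoras for an orthonormal pair: `‖s e₀ + t e₁‖² = s² + t²`. -/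
theorem ffrCount_norm_sq_combo {e₀ e₁ : EuclideanSpace ℝ (Fin 3)} (h0 : ‖e₀‖ = 1) (h1 : ‖e₁‖ = 1)
    (h01 : inner ℝ e₀ e₁ = 0) (s t : ℝ) : ‖s • e₀ + t • e₁‖ ^ 2 = s ^ 2 + t ^ 2 := by
  rw [norm_add_sq_real, norm_smul, norm_smul, real_inner_smul_left, real_inner_smul_right, h01, h0, h1,
    Real.norm_eq_abs, Real.norm_eq_abs]
  simp only [mul_one, mul_zero, add_zero, sq_abs]

/-- Triangle bound for a non-negative combination of an orthonormal (unit) pair. -/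
theorem ffrCount_norm_combo_le {e₀ e₁ : EuclideanSpace ℝ (Fin 3)} (h0 : ‖e₀‖ = 1) (h1 : ‖e₁‖ = 1)
    {s t : ℝ} (hs : 0 ≤ s) (ht : 0 ≤ t) : ‖s • e₀ + t • e₁‖ ≤ s + t := by
  calc ‖s • e₀ + t • e₁‖ ≤ ‖s • e₀‖ + ‖t • e₁‖ := norm_add_le _ _
    _ = s + t := by
      rw [norm_smul, norm_smul, h0, h1, Real.norm_eq_abs, Real.norm_eq_abs, abs_of_nonneg hs,
        abs_of_nonneg ht, mul_one, mul_one]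

/-- Distinct natural numbers differ by at least one: `1 ≤ (m - k)²` over `ℝ`. -/
theorem ffrCount_one_le_sq_sub {m k : ℕ} (h : m ≠ k) : (1 : ℝ) ≤ ((m : ℝ) - k) ^ 2 := by
  rcases Nat.lt_or_gt_of_ne h with hlt | hlt
  · have h' : (m : ℝ) + 1 ≤ k := by exact_mod_cast Nat.lt_iff_add_one_le.mp hlt
    nlinarith
  · have h' : (k : ℝ) + 1 ≤ m := by exact_mod_cast Nat.lt_iff_add_one_le.mp hlt
    nlinarith

/-- Grid separation: distinct points of the planar grid `(L i) e₀ + (L j) e₁` (`e₀, e₁`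
orthonormal) are at distance `≥ L` (trivially so when `L < 0`). -/
theorem ffrCount_grid_sep {e₀ e₁ : EuclideanSpace ℝ (Fin 3)} (h0 : ‖e₀‖ = 1) (h1 : ‖e₁‖ = 1)
    (h01 : inner ℝ e₀ e₁ = 0) (L : ℝ) {p q : ℕ × ℕ} (hpq : p ≠ q) :
    L ≤ ‖((L * p.1) • e₀ + (L * p.2) • e₁) - ((L * q.1) • e₀ + (L * q.2) • e₁)‖ := by
  have hint : (1 : ℝ) ≤ ((p.1 : ℝ) - q.1) ^ 2 + ((p.2 : ℝ) - q.2) ^ 2 := by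
    by_cases h : p.1 = q.1
    · have h2 : p.2 ≠ q.2 := fun h2 => hpq (Prod.ext h h2)
      nlinarith [ffrCount_one_le_sq_sub h2, sq_nonneg ((p.1 : ℝ) - q.1)]
    · nlinarith [ffrCount_one_le_sq_sub h, sq_nonneg ((p.2 : ℝ) - q.2)]
  have hdiff : ((L * p.1) • e₀ + (L * p.2) • e₁) - ((L * q.1) • e₀ + (L * q.2) • e₁)
      = (L * ((p.1 : ℝ) - q.1)) • e₀ + (L * ((p.2 : ℝ) - q.2)) • e₁ := by
    simp only [mul_sub, sub_smul]
    abel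
  rw [hdiff]
  have hsq : L ^ 2 ≤ ‖(L * ((p.1 : ℝ) - q.1)) • e₀ + (L * ((p.2 : ℝ) - q.2)) • e₁‖ ^ 2 := by
    rw [ffrCount_norm_sq_combo h0 h1 h01]
    nlinarith [sq_nonneg L]
  exact le_of_sq_le_sq hsq (norm_nonneg _)

/-- Core counting contradiction: a set `F ⊆ ℝ³` meeting every closed ball in a finite set and
`ρ`-dense in space (`ρ ≥ a > 0`) admits no linear census `ncard (F ∩ B̄(p, r)) ≤ C · r / a`
(`r ≥ a`): a planar grid of mesh `3ρ` and side `n` yields `n²` distinct members of `F` in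
`B̄(0, 7ρn)`, contradicting the census for `n > max 1 (7Cρ/a)`. -/
theorem ffrCount_core {F : Set (EuclideanSpace ℝ (Fin 3))} {a ρ C : ℝ} (ha : 0 < a) (hρ : a ≤ ρ)
    (hfin : ∀ (p : EuclideanSpace ℝ (Fin 3)) (r : ℝ), (F ∩ Metric.closedBall p r).Finite)
    (hcov : ∀ x : EuclideanSpace ℝ (Fin 3), ∃ f ∈ F, dist x f ≤ ρ)
    (hcen : ∀ (p : EuclideanSpace ℝ (Fin 3)) (r : ℝ), a ≤ r →
      ((F ∩ Metric.closedBall p r).ncard : ℝ) ≤ C * (r / a)) :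
    False := by
  obtain ⟨e₀, e₁, h0, h1, h01⟩ := ffrCount_exists_orthoPair
  have hρ0 : 0 < ρ := lt_of_lt_of_le ha hρ
  choose φ hφF hφd using hcov
  -- the grid
  obtain ⟨g, hg⟩ : ∃ g : ℕ × ℕ → EuclideanSpace ℝ (Fin 3),
      ∀ ij, g ij = (3 * ρ * ij.1) • e₀ + (3 * ρ * ij.2) • e₁ := ⟨_, fun _ => rfl⟩
  -- the side of the grid
  obtain ⟨K, hK⟩ : ∃ K : ℝ, K = 7 * C * ρ / a := ⟨_, rfl⟩
  obtain ⟨n, hn⟩ := exists_nat_gt (max 1 K)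
  have hn1 : (1 : ℝ) < n := lt_of_le_of_lt (le_max_left _ _) hn
  have hnK : K < n := lt_of_le_of_lt (le_max_right _ _) hn
  have hn0 : (0 : ℝ) < n := by linarith
  -- grid points followed by their five-sites are pairwise distinct
  have hinj : Set.InjOn (fun ij => φ (g ij)) ((Finset.range n ×ˢ Finset.range n : Finset (ℕ × ℕ)) :
      Set (ℕ × ℕ)) := by
    intro p _ q _ hpq
    have hpq' : φ (g p) = φ (g q) := hpq
    by_contra hne
    have hsep := ffrCount_grid_sep h0 h1 h01 (3 * ρ) hne
    rw [← hg, ← hg, ← dist_eq_norm] at hsep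
    have : dist (g p) (g q) ≤ 2 * ρ :=
      calc dist (g p) (g q) ≤ dist (g p) (φ (g p)) + dist (φ (g p)) (g q) := dist_triangle _ _ _
        _ ≤ ρ + ρ := by
          gcongr
          · exact hφd (g p)
          · rw [hpq', dist_comm]
            exact hφd (g q)
        _ = 2 * ρ := by ring
    linarith
  -- and they lie in the ball `B̄(0, 7ρn)`
  have hmem : ∀ ij ∈ ((Finset.range n ×ˢ Finset.range n : Finset (ℕ × ℕ)) : Set (ℕ × ℕ)),
      (fun ij => φ (g ij)) ij ∈ F ∩ Metric.closedBall (0 : EuclideanSpace ℝ (Fin 3)) (7 * ρ * n) := by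
    intro ij hij
    rw [Finset.mem_coe, Finset.mem_product, Finset.mem_range, Finset.mem_range] at hij
    refine ⟨hφF _, ?_⟩
    rw [Metric.mem_closedBall]
    have hi : (ij.1 : ℝ) ≤ n := by exact_mod_cast hij.1.le
    have hj : (ij.2 : ℝ) ≤ n := by exact_mod_cast hij.2.le
    have hgn : ‖g ij‖ ≤ 3 * ρ * ij.1 + 3 * ρ * ij.2 := by
      rw [hg]
      exact ffrCount_norm_combo_le h0 h1 (by positivity) (by positivity)
    have htri : dist (φ (g ij)) 0 ≤ dist (φ (g ij)) (g ij) + dist (g ij) 0 := dist_triangle _ _ _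
    rw [dist_zero_right (g ij), dist_comm (φ (g ij)) (g ij)] at htri
    have h1' := mul_le_mul_of_nonneg_left hi (by positivity : (0 : ℝ) ≤ 3 * ρ)
    have h2' := mul_le_mul_of_nonneg_left hj (by positivity : (0 : ℝ) ≤ 3 * ρ)
    have h3' : ρ ≤ ρ * n := le_mul_of_one_le_right hρ0.le hn1.le
    linarith [hφd (g ij)]
  -- count
  have hle : ((Finset.range n ×ˢ Finset.range n : Finset (ℕ × ℕ)) : Set (ℕ × ℕ)).ncard ≤
      (F ∩ Metric.closedBall (0 : EuclideanSpace ℝ (Fin 3)) (7 * ρ * n)).ncard :=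
    Set.ncard_le_ncard_of_injOn _ hmem hinj (hfin _ _)
  rw [Set.ncard_coe_finset, Finset.card_product, Finset.card_range] at hle
  have hr : a ≤ 7 * ρ * n := by nlinarith [mul_pos hρ0 (sub_pos.mpr hn1)]
  have hcen' := hcen 0 (7 * ρ * n) hr
  have hcast : ((n * n : ℕ) : ℝ) ≤
      ((F ∩ Metric.closedBall (0 : EuclideanSpace ℝ (Fin 3)) (7 * ρ * n)).ncard : ℝ) := by
    exact_mod_cast hle
  push_cast at hcast
  have hreal : (n : ℝ) * n ≤ K * n := by
    rw [hK, show 7 * C * ρ / a * (n : ℝ) = C * (7 * ρ * n / a) by ring]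
    exact hcast.trans hcen'
  have hlt : K * n < (n : ℝ) * n := mul_lt_mul_of_pos_right hnK hn0
  linarith

/-- **Stub 6 (counting glue, `CensusClosesCrux`).** In an all-gapped-twelve configuration that is
`3a`-relatively dense and has a linear census of five-sites (sites carrying a bond with `≥ 5` common
partners number `≤ C · r / a` in every ball of radius `r ≥ a`), for every `R` some site `c` has no
five-site bond starting within `R` of it: otherwise every point of space is within `R + 3a` of a
five-site and a planar grid produces quadratically many five-sites in a ball, against the census. -/
theorem stub_ffrCounting :
    ∀ (Y : Set (EuclideanSpace ℝ (Fin 3))) (a : ℝ), 0 < a → Y.Nonempty →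
      (∀ y ∈ Y, ({w ∈ Y | w ≠ y ∧ dist y w ≤ a * (1 + 1 / 50)}.ncard = 12 ∧
        ∀ w ∈ Y, w ≠ y → a * (1 - 1 / 50) ≤ dist y w ∧
          (dist y w ≤ a * (1 + 1 / 50) ∨ a * (63 / 50) ≤ dist y w))) →
      (∀ p : EuclideanSpace ℝ (Fin 3), ∃ y ∈ Y, dist p y ≤ 3 * a) →
      (∃ C : ℝ, ∀ (p : EuclideanSpace ℝ (Fin 3)) (r : ℝ), a ≤ r →
        (({y ∈ Y | ∃ v ∈ Y, v ≠ y ∧ dist y v ≤ a * (1 + 1 / 50) ∧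
            5 ≤ {w ∈ Y | w ≠ y ∧ w ≠ v ∧ dist y w ≤ a * (1 + 1 / 50) ∧
              dist v w ≤ a * (1 + 1 / 50)}.ncard} ∩ Metric.closedBall p r).ncard : ℝ) ≤ C * (r / a)) →
      ∀ R : ℝ, ∃ c ∈ Y, ∀ y ∈ Y, dist y c ≤ R → ∀ v ∈ Y, v ≠ y → dist y v ≤ a * (1 + 1 / 50) →
        {w ∈ Y | w ≠ y ∧ w ≠ v ∧ dist y w ≤ a * (1 + 1 / 50) ∧ dist v w ≤ a * (1 + 1 / 50)}.ncard ≤ 4 := by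
  intro Y a ha hne hgap hRD hC R
  obtain ⟨C, hC⟩ := hC
  by_contra h
  push Not at h
  -- `h`: every site has a five-site within `R`; with `Y` non-empty this forces `0 ≤ R`
  have hR0 : 0 ≤ R := by
    obtain ⟨c, hc⟩ := hne
    obtain ⟨y, -, hyc, -⟩ := h c hc
    exact dist_nonneg.trans hyc
  refine ffrCount_core (ρ := R + 3 * a) ha (by linarith) ?_ ?_ hC
  · -- hard core: five-sites in a ball form a finite set
    intro p r
    refine finite_of_forall_le_dist_of_subset_closedBall (δ := a * (1 - 1 / 50)) (by positivity) ?_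
      Set.inter_subset_right
    rintro u ⟨⟨huY, -⟩, -⟩ w ⟨⟨hwY, -⟩, -⟩ huw
    exact ((hgap u huY).2 w hwY (Ne.symm huw)).1
  · -- relative denseness: every point of space has a five-site within `R + 3a`
    intro x
    obtain ⟨y, hyY, hxy⟩ := hRD x
    obtain ⟨y', hy'Y, hy'y, v, hvY, hvy', hdy'v, hcnt⟩ := h y hyY
    refine ⟨y', ⟨hy'Y, v, hvY, hvy', hdy'v, Nat.succ_le_of_lt hcnt⟩, ?_⟩
    calc dist x y' ≤ dist x y + dist y y' := dist_triangle _ _ _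
      _ ≤ 3 * a + R := add_le_add hxy (by rw [dist_comm]; exact hy'y)
      _ = R + 3 * a := by ring

end Summit.AtomisticToContinuum.Crystallization.Theorems

end
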